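import Summits.HodgeConjecture.HodgeConjecture.Theorems.F0P2aArchOrthCore
import Summits.HodgeConjecture.HodgeConjecture.Theorems.F0P2aL2eExpGeneration
import Literature.NumberTheory.Automorphic.U21AnalyticVectors
import HarnessLib

/-!
# Crux `H413` — RUNG 1½ «ISOTYPY FROM A NULL CORE», brick B3 (datum-free half): the `L²`-closure of the `𝔤`-span of a `𝔭⁻`-null
# `𝔨`-stable finite-dimensional space of smooth functions is a CLOSED `U(2,1)`-INVARIANT SUBSPACE

Floor-0 programme P3 «U3-mult», seat F0P3-p02 (g3); crux item stmt-HodgeConjecture-24833 (`HCCMUnconditional.H413`); design note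
`F0/P3/STATUS.md` 2026-08-31T01:05Z (road «F1a in-house at the pin», bricks B1 ★pending `F0P3GenIrreducibleOfUnitary`, B2 ★pending
`Literature/…/HarishChandraModuleIntertwiners`).  HC_CM is proved only modulo the printed citations until rung 0 closes.

THE STATEMENT (`rightRegular_mem_closure_lieSpan`).  Datum-free frame of F0P2a's S2⁺ core (★ `F0P2aArchOrthHol.core`): any adelic group
datum `𝒢`, automorphic `μ`, continuous `ι : U(2,1) →* G(𝔸)`, an `L²`-Lie-stable space `W` of `ι`-smooth functions with injective class map, a
finite-dimensional `V ≤ W` stable under the Lie derivatives along `𝔨 = 𝔲(2,1) ∩ 𝔲(3)` and `𝔭⁻`-null (`X_{ib} ψ = c X_b ψ`, `c² = −1`).  Let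
`S` be the `𝔤`-span of `V` (the span of all iterated Lie derivatives of elements of `V`) and `C` the topological closure in `L²` of the space of
classes of `S` (★ `l2OfForms 𝒢 μ S`).  THEN `C` IS STABLE UNDER `R(ι u)` FOR EVERY `u ∈ U(2,1)` — and `y ∈ C ↔ R(ι u) y ∈ C`.

PROOF = the invariance half of ★ `F0P2aArchOrthHol.core` (F0P2a-p01), extracted and with its two analytic inputs DISCHARGED BY NAME instead of
carried as hypotheses: Harish-Chandra's closure theorem ★ `closure_l2OfForms_exp_invariant_of_analytic_of_memLp` for the archimedean-only
automorphy datum `(u21Group, ι, ⊥, {⊥}, 0)` makes `C` stable under `R(ι (exp X))`, its analyticity input being Nelson–Harish-Chandra ★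
`analyticAt_inner_rightRegular_toLp_of_u21_null_of_mem_lieSpan` (F0P2a L2d); the stabiliser `{u | R(ι u) C = C}` is then a subgroup of `U(2,1)`
containing `exp 𝔲(2,1)`, hence everything (★ `F0P2aL2eExpGeneration.subgroup_eq_top_of_forall_expMem_mem`, F0P2a L2e).
Also: the classes of `V` (indeed of `S`) lie in `C` (`toLp_mem_closure_lieSpan`).

WHY (road B3 → B4).  For a holomorphic cotangent form `Φ` with classes in a discrete `P`, `V = ℂΦ₀ + ℂΦ₁` is such a space (CR from ★
`IsHolGerm`, `𝔨`-stability from the `K_∞`-type — exactly as in ★ `F0P2aArchOrthHol.archOrthHol_of_cuts`), so `C_Φ ⊆ P.space` is a closed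
`ι_∞(U(2,1))`-invariant subspace whose smooth `K`-finite vectors form the irreducible module `gen` of brick B1; the orthogonal projection onto
`C_Φ` (brick B2 ★ `DiscreteAutomorphicRep.starProjection_archRep`) then detects the archimedean module of `P` WITHOUT letter F1a.

No definition, no sorry, no named fact; `--supports stmt-HodgeConjecture-24833 --as helper`.

References: [HarishChandraTAMS1953] Harish-Chandra, Trans. AMS 75 (1953), Cor. to Thm 2, Lemma 34; [Nelson1959] E. Nelson, Ann. Math. 70 (1959) §8;
[Knapp2002] I.§10 Cor. 1.103; [BorelWallach2000] VII 3.2.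
-/

set_option autoImplicit false
-- the mandated namespace repeats `HodgeConjecture.HodgeConjecture`, as in every `Theorems/*.lean` of this sub-problem
set_option linter.dupNamespace false

noncomputable section

open scoped Matrix MatrixGroups Topology InnerProductSpace ENNReal ComplexConjugate ComplexOrder
open MeasureTheory NumberField Filter MulAction
open Literature.NumberTheory.Automorphic
open Literature.Geometry.ComplexHyperbolic Literature.Geometry.ComplexHyperbolic.BallModel
open Literature.AlgebraicGeometry.ShimuraVarieties Literature.AlgebraicGeometry.ShimuraVarieties.BallForms
open Summit.HodgeConjecture.HodgeConjecture.Cruxes.H413.F0P2aArchOrthHol (lieSpan_le le_lieSpan lieDeriv_mem_lieSpan)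
open Summit.HodgeConjecture.HodgeConjecture.Cruxes.H413.F0P2aL2eExpGeneration (subgroup_eq_top_of_forall_expMem_mem)

namespace Summit.HodgeConjecture.HodgeConjecture.Cruxes.H413.F0P3LieSpanClosureInvariant

variable {K : Type} [Field K] [NumberField K] {𝒢 : AdelicGroupData K}
  {μ : Measure 𝒢.automorphicQuotient} [𝒢.IsAutomorphicMeasure μ]

/-- **Harish-Chandra's closure theorem along `exp`**, datum-free frame: under the standing hypotheses on `W` and `V`, the closure `C` of the
classes of the `𝔤`-span `S` of `V` is stable under `R(ι (exp X))` for every `X ∈ 𝔲(2,1)` (★ `closure_l2OfForms_exp_invariant_of_analytic_of_memLp`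
for the archimedean-only datum `(u21Group, ι)`, fed with ★ `analyticAt_inner_rightRegular_toLp_of_u21_null_of_mem_lieSpan`).
[cite: HarishChandraTAMS1953, Cor. to Thm 2; Lemma 34] [cite: Nelson1959, §8] -/
theorem rightRegular_expMem_mem_closure_lieSpan (ι : U21 →* 𝒢.Adelic) (hι : Continuous ι)
    (W : Submodule ℂ (𝒢.Adelic → ℂ))
    (hsm : ∀ φ ∈ W, IsArchSmooth (H := u21Group) ι φ)
    (hlie : ∀ X : u21Group.lie, ∀ φ ∈ W, lieDeriv (H := u21Group) ι X φ ∈ W)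
    (hrep : W ≤ 𝒢.l2Representable μ)
    (hinj : ∀ (φ : 𝒢.Adelic → ℂ) (hφ : φ ∈ W), 𝒢.l2ClassOf μ ⟨φ, hrep hφ⟩ = 0 → φ = 0)
    (V : Submodule ℂ (𝒢.Adelic → ℂ)) [FiniteDimensional ℂ V] (hVW : V ≤ W)
    (hVk : ∀ Y : u21Group.lie, (Y : Matrix (Fin 3) (Fin 3) ℂ) ∈ u21Group.compactLie → ∀ ψ ∈ V, lieDeriv (H := u21Group) ι Y ψ ∈ V)
    {c : ℂ} (hc : c * c = -1)
    (hVcr : ∀ ψ ∈ V, ∀ b : Fin 2 → ℂ,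
      lieDeriv (H := u21Group) ι (liePMat (Complex.I • b)) ψ = c • lieDeriv (H := u21Group) ι (liePMat b) ψ)
    (X : u21Group.lie) {y : 𝒢.L2 μ}
    (hy : y ∈ (l2OfForms 𝒢 μ (Submodule.span ℂ
      {χ | ∃ (l : List u21Group.lie) (ψ : 𝒢.Adelic → ℂ), ψ ∈ V ∧ χ = iterLieDeriv (H := u21Group) ι l ψ})).topologicalClosure) :
    𝒢.rightRegular μ (ι (u21Group.expMem X)) y ∈ (l2OfForms 𝒢 μ (Submodule.span ℂ
      {χ | ∃ (l : List u21Group.lie) (ψ : 𝒢.Adelic → ℂ), ψ ∈ V ∧ χ = iterLieDeriv (H := u21Group) ι l ψ})).topologicalClosure := by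
  -- the `𝔤`-span `S` of `V`
  set S : Submodule ℂ (𝒢.Adelic → ℂ) :=
    Submodule.span ℂ {χ | ∃ (l : List u21Group.lie) (ψ : 𝒢.Adelic → ℂ), ψ ∈ V ∧ χ = iterLieDeriv (H := u21Group) ι l ψ} with hS_def
  have hSW : S ≤ W := lieSpan_le ι hVW hlie
  have hSlie : ∀ X : u21Group.lie, ∀ φ ∈ S, lieDeriv (H := u21Group) ι X φ ∈ S := fun X φ hφ =>
    lieDeriv_mem_lieSpan ι hsm hlie hVW X hφ
  -- the archimedean-only automorphy datum `(u21Group, ι)`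
  let 𝒟 : AutomorphyDatum 𝒢 ℂ (Fin 3) :=
    { arch := u21Group
      ofArch := ι
      continuous_ofArch := hι
      finiteAdelic := ⊥
      commute_ofArch := fun g h hh => by
        rw [Subgroup.mem_bot] at hh
        rw [hh, mul_one, one_mul]
      finiteLevels := {⊥}
      finiteLevels_nonempty := ⟨⊥, rfl⟩
      le_finiteAdelic := fun U hU => by
        rw [Set.mem_singleton_iff] at hU
        rw [hU]
      height := 0 }
  refine closure_l2OfForms_exp_invariant_of_analytic_of_memLp 𝒟 (W := S) hSlie (fun φ hφ => hsm φ (hSW hφ))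
    (fun φ hφ => ?_) (fun f hf hfS X' v => ?_) X hy
  · obtain ⟨f, hf, hfe⟩ := hrep (hSW hφ)
    exact ⟨f, hf, hfe⟩
  · exact analyticAt_inner_rightRegular_toLp_of_u21_null_of_mem_lieSpan ι hι hsm hlie hrep hinj V hVW hVk c hc hVcr hfS hf rfl X' v 0

/-- **THE CLOSURE OF THE `𝔤`-SPAN IS `U(2,1)`-INVARIANT.**  Same hypotheses; for every `u ∈ U(2,1)`: `y ∈ C ↔ R(ι u) y ∈ C`, where `C` is the
`L²`-closure of the classes of the `𝔤`-span of `V`.  The stabiliser of `C` is a subgroup of `U(2,1)` containing `exp 𝔲(2,1)`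
(`rightRegular_expMem_mem_closure_lieSpan`), hence all of the connected group `U(2,1)` (★ `subgroup_eq_top_of_forall_expMem_mem`).
[cite: HarishChandraTAMS1953, Cor. to Thm 2] [cite: Knapp2002, I.§10 Cor. 1.103] -/
theorem mem_closure_lieSpan_iff_rightRegular_mem (ι : U21 →* 𝒢.Adelic) (hι : Continuous ι)
    (W : Submodule ℂ (𝒢.Adelic → ℂ))
    (hsm : ∀ φ ∈ W, IsArchSmooth (H := u21Group) ι φ)
    (hlie : ∀ X : u21Group.lie, ∀ φ ∈ W, lieDeriv (H := u21Group) ι X φ ∈ W)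
    (hrep : W ≤ 𝒢.l2Representable μ)
    (hinj : ∀ (φ : 𝒢.Adelic → ℂ) (hφ : φ ∈ W), 𝒢.l2ClassOf μ ⟨φ, hrep hφ⟩ = 0 → φ = 0)
    (V : Submodule ℂ (𝒢.Adelic → ℂ)) [FiniteDimensional ℂ V] (hVW : V ≤ W)
    (hVk : ∀ Y : u21Group.lie, (Y : Matrix (Fin 3) (Fin 3) ℂ) ∈ u21Group.compactLie → ∀ ψ ∈ V, lieDeriv (H := u21Group) ι Y ψ ∈ V)
    {c : ℂ} (hc : c * c = -1)
    (hVcr : ∀ ψ ∈ V, ∀ b : Fin 2 → ℂ,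
      lieDeriv (H := u21Group) ι (liePMat (Complex.I • b)) ψ = c • lieDeriv (H := u21Group) ι (liePMat b) ψ)
    (u : U21) (y : 𝒢.L2 μ) :
    y ∈ (l2OfForms 𝒢 μ (Submodule.span ℂ
      {χ | ∃ (l : List u21Group.lie) (ψ : 𝒢.Adelic → ℂ), ψ ∈ V ∧ χ = iterLieDeriv (H := u21Group) ι l ψ})).topologicalClosure ↔
    𝒢.rightRegular μ (ι u) y ∈ (l2OfForms 𝒢 μ (Submodule.span ℂ
      {χ | ∃ (l : List u21Group.lie) (ψ : 𝒢.Adelic → ℂ), ψ ∈ V ∧ χ = iterLieDeriv (H := u21Group) ι l ψ})).topologicalClosure := by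
  set C : Submodule ℂ (𝒢.L2 μ) := (l2OfForms 𝒢 μ (Submodule.span ℂ
      {χ | ∃ (l : List u21Group.lie) (ψ : 𝒢.Adelic → ℂ), ψ ∈ V ∧ χ = iterLieDeriv (H := u21Group) ι l ψ})).topologicalClosure with hC_def
  have hcl : ∀ (X : u21Group.lie) (y : 𝒢.L2 μ), y ∈ C → 𝒢.rightRegular μ (ι (u21Group.expMem X)) y ∈ C := fun X y hy =>
    rightRegular_expMem_mem_closure_lieSpan ι hι W hsm hlie hrep hinj V hVW hVk hc hVcr X hy
  have hRmul : ∀ (a b : 𝒢.Adelic) (y : 𝒢.L2 μ), 𝒢.rightRegular μ (a * b) y = 𝒢.rightRegular μ a (𝒢.rightRegular μ b y) :=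
    fun a b y => by rw [map_mul]; rfl
  have hR1 : ∀ y : 𝒢.L2 μ, 𝒢.rightRegular μ 1 y = y := fun y => by rw [map_one]; rfl
  -- the stabiliser of `C` in `U(2,1)`
  let Sg : Subgroup ↥U21 :=
    { carrier := {g | ∀ y : 𝒢.L2 μ, y ∈ C ↔ 𝒢.rightRegular μ (ι g) y ∈ C}
      one_mem' := fun y => by rw [map_one, hR1]
      mul_mem' := fun {g g'} hg hg' y => by
        rw [map_mul, hRmul]
        exact (hg' y).trans (hg _)
      inv_mem' := fun {g} hg y => by
        have h := (hg (𝒢.rightRegular μ (ι g⁻¹) y)).symm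
        rwa [← hRmul, ← map_mul, mul_inv_cancel, map_one, hR1] at h }
  have hexp : ∀ X : u21Group.lie, (u21Group.expMem X : ↥U21) ∈ Sg := by
    intro X y
    have e0 : u21Group.expMem ((-1 : ℝ) • X) * u21Group.expMem ((1 : ℝ) • X) = 1 := by
      rw [← RealMatrixGroup.expMem_add_smul, show (-1 : ℝ) + 1 = 0 by norm_num]
      exact RealMatrixGroup.expMem_zero_smul X
    rw [one_smul] at e0
    have e1 : ι (u21Group.expMem ((-1 : ℝ) • X)) * ι (u21Group.expMem X) = 1 := by
      rw [← map_mul]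
      exact (congrArg ι e0).trans (map_one ι)
    constructor
    · exact hcl X y
    · intro h
      have h2 := hcl ((-1 : ℝ) • X) _ h
      rw [← hRmul, e1, hR1] at h2
      exact h2
  have hSg : Sg = ⊤ := subgroup_eq_top_of_forall_expMem_mem Sg hexp
  have hu : u ∈ Sg := by rw [hSg]; exact Subgroup.mem_top u
  exact hu y

/-- **`C` is `R(ι u)`-stable** (the forward direction of `mem_closure_lieSpan_iff_rightRegular_mem`). [cite: HarishChandraTAMS1953, Cor. to Thm 2] -/
theorem rightRegular_mem_closure_lieSpan (ι : U21 →* 𝒢.Adelic) (hι : Continuous ι)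
    (W : Submodule ℂ (𝒢.Adelic → ℂ))
    (hsm : ∀ φ ∈ W, IsArchSmooth (H := u21Group) ι φ)
    (hlie : ∀ X : u21Group.lie, ∀ φ ∈ W, lieDeriv (H := u21Group) ι X φ ∈ W)
    (hrep : W ≤ 𝒢.l2Representable μ)
    (hinj : ∀ (φ : 𝒢.Adelic → ℂ) (hφ : φ ∈ W), 𝒢.l2ClassOf μ ⟨φ, hrep hφ⟩ = 0 → φ = 0)
    (V : Submodule ℂ (𝒢.Adelic → ℂ)) [FiniteDimensional ℂ V] (hVW : V ≤ W)
    (hVk : ∀ Y : u21Group.lie, (Y : Matrix (Fin 3) (Fin 3) ℂ) ∈ u21Group.compactLie → ∀ ψ ∈ V, lieDeriv (H := u21Group) ι Y ψ ∈ V)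
    {c : ℂ} (hc : c * c = -1)
    (hVcr : ∀ ψ ∈ V, ∀ b : Fin 2 → ℂ,
      lieDeriv (H := u21Group) ι (liePMat (Complex.I • b)) ψ = c • lieDeriv (H := u21Group) ι (liePMat b) ψ)
    (u : U21) {y : 𝒢.L2 μ}
    (hy : y ∈ (l2OfForms 𝒢 μ (Submodule.span ℂ
      {χ | ∃ (l : List u21Group.lie) (ψ : 𝒢.Adelic → ℂ), ψ ∈ V ∧ χ = iterLieDeriv (H := u21Group) ι l ψ})).topologicalClosure) :
    𝒢.rightRegular μ (ι u) y ∈ (l2OfForms 𝒢 μ (Submodule.span ℂ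
      {χ | ∃ (l : List u21Group.lie) (ψ : 𝒢.Adelic → ℂ), ψ ∈ V ∧ χ = iterLieDeriv (H := u21Group) ι l ψ})).topologicalClosure :=
  (mem_closure_lieSpan_iff_rightRegular_mem ι hι W hsm hlie hrep hinj V hVW hVk hc hVcr u y).1 hy

omit [𝒢.IsAutomorphicMeasure μ] in
/-- The class of every `ℒ²` function whose pull-back lies in the `𝔤`-span of `V` — in particular of every element of `V` — lies in `C`.
[cite: BorelJacquet1979, §4.6] -/
theorem toLp_mem_closure_lieSpan (ι : U21 →* 𝒢.Adelic) (V : Submodule ℂ (𝒢.Adelic → ℂ))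
    {f : 𝒢.automorphicQuotient → ℂ} (hf : MemLp f 2 μ)
    (hfV : invQuot 𝒢 f ∈ Submodule.span ℂ
      {χ | ∃ (l : List u21Group.lie) (ψ : 𝒢.Adelic → ℂ), ψ ∈ V ∧ χ = iterLieDeriv (H := u21Group) ι l ψ}) :
    hf.toLp f ∈ (l2OfForms 𝒢 μ (Submodule.span ℂ
      {χ | ∃ (l : List u21Group.lie) (ψ : 𝒢.Adelic → ℂ), ψ ∈ V ∧ χ = iterLieDeriv (H := u21Group) ι l ψ})).topologicalClosure :=
  Submodule.le_topologicalClosure _ (toLp_mem_l2OfForms hf hfV)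

omit [𝒢.IsAutomorphicMeasure μ] in
/-- The class of an `ℒ²` function whose pull-back lies in `V` itself lies in `C` (`V ≤` its `𝔤`-span, ★ `le_lieSpan`). [cite: BorelJacquet1979, §4.6] -/
theorem toLp_mem_closure_lieSpan_of_mem (ι : U21 →* 𝒢.Adelic) (V : Submodule ℂ (𝒢.Adelic → ℂ))
    {f : 𝒢.automorphicQuotient → ℂ} (hf : MemLp f 2 μ) (hfV : invQuot 𝒢 f ∈ V) :
    hf.toLp f ∈ (l2OfForms 𝒢 μ (Submodule.span ℂ
      {χ | ∃ (l : List u21Group.lie) (ψ : 𝒢.Adelic → ℂ), ψ ∈ V ∧ χ = iterLieDeriv (H := u21Group) ι l ψ})).topologicalClosure :=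
  toLp_mem_closure_lieSpan ι V hf (le_lieSpan ι V hfV)

omit [𝒢.IsAutomorphicMeasure μ] in
/-- **Containment in a closed subspace**: if the classes of the `𝔤`-span of `V` lie in a closed subspace `P` of `L²` (e.g. a discrete automorphic
`P.space`) then so does `C`. [folklore] -/
theorem closure_lieSpan_le_of_l2OfForms_le (ι : U21 →* 𝒢.Adelic) (V : Submodule ℂ (𝒢.Adelic → ℂ)) {P : Submodule ℂ (𝒢.L2 μ)}
    (hP : IsClosed (P : Set (𝒢.L2 μ)))
    (hle : l2OfForms 𝒢 μ (Submodule.span ℂ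
      {χ | ∃ (l : List u21Group.lie) (ψ : 𝒢.Adelic → ℂ), ψ ∈ V ∧ χ = iterLieDeriv (H := u21Group) ι l ψ}) ≤ P) :
    (l2OfForms 𝒢 μ (Submodule.span ℂ
      {χ | ∃ (l : List u21Group.lie) (ψ : 𝒢.Adelic → ℂ), ψ ∈ V ∧ χ = iterLieDeriv (H := u21Group) ι l ψ})).topologicalClosure ≤ P :=
  Submodule.topologicalClosure_minimal _ hle hP

end Summit.HodgeConjecture.HodgeConjecture.Cruxes.H413.F0P3LieSpanClosureInvariant

end
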